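import Summits.QuantumFields.YangMills.Theorems.BalabanUVNodesPortS1JacCover

/-!
# NODE O port PT-A — ROW (e) OF `stub_LZjac`, THE UNIVERSAL-COVER BRIDGE, PART 2: the derivative block and the Jacobian functional under the cover —
# `A₁^ℂ(π_{j+1} ĉ)(W) = A₁^ℤ(ĉ)(W ∘ π_j)` and ★★★ `J_T(π_{k+1} ĉ, 𝐔) = J_ℤ(ĉ, 𝐔 ∘ π_0)` for EVERY configuration (standing range)

Cell `ym-nodeO-ideate`, porter seat `ymgap-nodeO-port-PTA-1` (gen 6); `--supports stmt-QuantumFields-27930` (helper); objects ✓ `…PortS1JacPiecesDefs`, part 1 ✓ `…PortS1JacCover`.  [I] = [Balaban1987RG1].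
WHY.  The only finite-dimensional ingredient of the δ-Jacobian piece is the derivative of the (0.4) average at the central bond.  On the torus it is the COMPONENTWISE `fderiv` of
`W ↦ avgMh W c` (✓ `jacBlockCt`); on `ℤ^d` it is the `fderiv` of the window-restricted average `avgMhZW` (✓ `jacBlockZ`).  The torus map factors through the WINDOW CHART of the cover
(`W ↦ (W ∘ π_j)|_window`, a surjective continuous linear map — `π_j` is injective on the window, `injOn_coverAt_winSitesZ`), and `fderiv` through a surjective linear map is computed
UNCONDITIONALLY (`fderiv_comp_surjective_clm`: chain rule where differentiable, `0 = 0` where not), so the two blocks agree as TOTAL functions — no smallness hypothesis.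
* §4 `fderiv_comp_surjective_clm` [folklore]; `injOn_coverAt_winSitesZ`, `coverBondAt_injOn_winBondsZ`, `exists_winChart`, `restrictZ_comp_coverBondAt_surjective`, `avgMh_coverBondAt_eq_avgMhZW`,
  `restrictZ_single_coverBondAt`, ★★ `jacBlockCt_coverBondAt`, `jacFactorCt_coverBondAt`, ★★★ `jacTorus_coverBondAt`.

HONEST FRAMING.  Calculus ∕ lattice bookkeeping over the tree's own (0.4) model; NOTHING of Bałaban's estimates asserted, ported or discharged; `stub_LZjac` OPEN; 27930 OPEN · no claim;
K0⁷∕K-Ax OPEN; NODE O 0∕1; COUNT 8∕28 · K 1∕4 UNMOVED; finite `𝕋⁴_{L^K}` at fixed ε — NOT continuum ∕ OS ∕ Clay; **the Yang–Mills mass gap is NOT proved by any of this.**  No `sorry`,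
no `def`, no `instance`, no `notation`; standard axioms.
-/

noncomputable section

open scoped BigOperators Matrix.Norms.L2Operator Topology

namespace Summit.QuantumFields.YangMills.Theorems.BalabanUVNodesPortS1

open Summit.QuantumFields.YangMills.Theorems.K0RecordFormatNames
open Literature.MathematicalPhysics.QuantumFieldTheory.Balaban1983to89
open Literature.MathematicalPhysics.QuantumFieldTheory.Balaban1983to89.Node00
open Literature.MathematicalPhysics.QuantumFieldTheory.Balaban1983to89.T4Continuum (T4Family Letter LStep)
open Literature.MathematicalPhysics.QuantumFieldTheory.Balaban1983to89.BlockAveragingHaarAC (centralBond)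
open Literature.MathematicalPhysics.QuantumFieldTheory.Balaban1983to89.B15AveragingHolomorphic (avgMh iterMh)
open Literature.MathematicalPhysics.QuantumFieldTheory.Balaban1983to89.B7Prop1Explicit (e e_apply)
open Literature.MathematicalPhysics.QuantumFieldTheory.Balaban1983to89.BlockAveragingZd (IdxZ offZ)
open Literature.MathematicalPhysics.QuantumLattice (blockMap blockSites mem_blockSites_iff)
open _root_.Matrix
/-! ## §4  The derivative through a surjective linear map; the window chart of the cover; the derivative block and the Jacobian functional under the cover -/

section DerivBridge

/-- **`fderiv` through a SURJECTIVE continuous linear map, unconditionally**: `D(G ∘ ρ)(x)[v] = DG(ρ x)[ρ v]` — by the chain rule where `G` is differentiable at `ρ x`, and `0 = 0`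
where it is not (then `G ∘ ρ` is not differentiable at `x` either: `G = (G ∘ ρ) ∘ A` for the affine section `A y = σ y + (x − σ (ρ x))` through `x`). [folklore] -/
theorem fderiv_comp_surjective_clm {𝕜 : Type*} [NontriviallyNormedField 𝕜] [CompleteSpace 𝕜] {E E' F' : Type*} [NormedAddCommGroup E] [NormedSpace 𝕜 E]
    [NormedAddCommGroup E'] [NormedSpace 𝕜 E'] [NormedAddCommGroup F'] [NormedSpace 𝕜 F'] [FiniteDimensional 𝕜 E] [FiniteDimensional 𝕜 E']
    (G : E' → F') (ρ : E →L[𝕜] E') (hρ : Function.Surjective ρ) (x v : E) :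
    fderiv 𝕜 (G ∘ ρ) x v = fderiv 𝕜 G (ρ x) (ρ v) := by
  by_cases hG : DifferentiableAt 𝕜 G (ρ x)
  · rw [fderiv_comp x hG ρ.differentiableAt, ρ.fderiv]
    rfl
  · obtain ⟨g, hg⟩ := (ρ : E →ₗ[𝕜] E').exists_rightInverse_of_surjective (LinearMap.range_eq_top.2 hρ)
    let σ : E' →L[𝕜] E := LinearMap.toContinuousLinearMap g
    have hσ : ∀ y, ρ (σ y) = y := fun y => by
      have h1 := LinearMap.congr_fun hg y
      simpa [σ] using h1
    have hGρ : ¬ DifferentiableAt 𝕜 (G ∘ ρ) x := by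
      intro hd
      apply hG
      have hA : DifferentiableAt 𝕜 (fun y : E' => σ y + (x - σ (ρ x))) (ρ x) := (σ.differentiableAt).add_const _
      have hx' : σ (ρ x) + (x - σ (ρ x)) = x := add_sub_cancel _ _
      have hcomp : G = (G ∘ ρ) ∘ fun y : E' => σ y + (x - σ (ρ x)) := by
        funext y
        simp [Function.comp_apply, map_add, map_sub, hσ]
      have hd' : DifferentiableAt 𝕜 (G ∘ ρ) (σ (ρ x) + (x - σ (ρ x))) := by rw [hx']; exact hd
      rw [hcomp]
      exact hd'.comp (ρ x) hA
    rw [fderiv_zero_of_not_differentiableAt hG, fderiv_zero_of_not_differentiableAt hGρ]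
    rfl

variable {P : Params} {j : ℕ}

/-- ★ **THE LEVEL-`j` COVER IS INJECTIVE ON THE WINDOW** `B(ĉ₋) ∪ B(ĉ₊) ⊂ ℤ^d` (standing range `j + 1 ≤ m + K`): two window sites differ by less than `2L ≤ 2L^{m+K−j}` in every coordinate.
[cite: Balaban1987RG1, (0.1) p.251, (1.21) p.264] -/
theorem injOn_coverAt_winSitesZ (hj : j + 1 ≤ P.m + P.K) (ĉ : (Fin P.d → ℤ) × Fin P.d) : Set.InjOn (coverAt P j) ↑(winSitesZ P.L ĉ) := by
  haveI : NeZero P.L := ⟨P.L_pos.ne'⟩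
  have hLpos : (0 : ℤ) < P.L := by exact_mod_cast P.L_pos
  have hS : 2 * (P.L : ℤ) ≤ (P.sitesPerDir j : ℕ) := by
    have h1 : P.sitesPerDir j = 2 * P.L ^ (P.m + P.K - j) := rfl
    have h2 : P.L ≤ P.L ^ (P.m + P.K - j) := by
      calc P.L = P.L ^ 1 := (pow_one _).symm
        _ ≤ P.L ^ (P.m + P.K - j) := Nat.pow_le_pow_right P.L_pos (by omega)
    rw [h1]; push_cast; nlinarith
  -- window sites: coordinates in `[L y_i, L y_i + L)` transversally and `[L y_μ, L y_μ + 2L)` longitudinally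
  have hwin : ∀ z ∈ (winSitesZ P.L ĉ : Finset _), ∀ i, (P.L : ℤ) * ĉ.1 i ≤ z i ∧ z i < (P.L : ℤ) * ĉ.1 i + 2 * P.L := by
    intro z hz i
    rw [winSitesZ, Finset.mem_union, mem_blockSites_iff, mem_blockSites_iff] at hz
    have key : ∀ y' : Fin P.d → ℤ, blockMap P.L z = y' → (P.L : ℤ) * y' i ≤ z i ∧ z i < (P.L : ℤ) * y' i + P.L := by
      intro y' hy'
      have h := congrFun hy' i
      simp only [blockMap] at h
      have h1 := Int.emod_add_mul_ediv (z i) (P.L : ℤ)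
      have h3 := Int.emod_nonneg (z i) hLpos.ne'
      have h4 := Int.emod_lt_of_pos (z i) hLpos
      rw [h] at h1
      constructor <;> linarith
    rcases hz with hz | hz
    · have := key _ hz; constructor <;> linarith
    · have := key _ hz
      simp only [Pi.add_apply, e_apply] at this
      by_cases hi : i = ĉ.2
      · rw [if_pos hi] at this; constructor <;> linarith
      · rw [if_neg hi] at this; constructor <;> linarith
  intro z hz z' hz' h
  funext i
  have hdvd : ((P.sitesPerDir j : ℕ) : ℤ) ∣ z' i - z i := (ZMod.intCast_eq_intCast_iff_dvd_sub (z i) (z' i) _).1 (congrFun h i)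
  have h1 := hwin z hz i
  have h2 := hwin z' hz' i
  have habs : |z' i - z i| < (P.sitesPerDir j : ℕ) := by rw [abs_lt]; constructor <;> linarith
  have := Int.eq_zero_of_abs_lt_dvd hdvd habs
  linarith

/-- The cover on bonds is injective on the window bonds. [cite: Balaban1987RG1, (1.21) p.264 (bookkeeping)] -/
theorem coverBondAt_injOn_winBondsZ (hj : j + 1 ≤ P.m + P.K) (ĉ : (Fin P.d → ℤ) × Fin P.d) {b b' : (Fin P.d → ℤ) × Fin P.d}
    (hb : b ∈ winBondsZ P.L ĉ) (hb' : b' ∈ winBondsZ P.L ĉ) (h : coverBondAt P j b = coverBondAt P j b') : b = b' := by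
  have h1 : coverAt P j b.1 = coverAt P j b'.1 := congrArg PBond.src h
  have h2 : b.2 = b'.2 := congrArg PBond.dir h
  exact Prod.ext (injOn_coverAt_winSitesZ hj ĉ (mem_winBondsZ_iff.1 hb).1 (mem_winBondsZ_iff.1 hb').1 h1) h2

/-- **The window chart of the cover**: restriction of a level-`j` torus configuration, pulled back through `π_j`, to the window bonds of `ĉ` — a continuous linear map.
[cite: Balaban1987RG1, (1.21) p.264 (bookkeeping)] -/
theorem exists_winChart (ĉ : (Fin P.d → ℤ) × Fin P.d) :
    ∃ ρ : (PBond P j → MatA 2) →L[ℂ] (↥(winBondsZ P.L ĉ) → MatA 2), ∀ W, ρ W = restrictZ (winBondsZ P.L ĉ) (fun b => W (coverBondAt P j b)) :=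
  ⟨ContinuousLinearMap.pi fun b : ↥(winBondsZ P.L ĉ) => ContinuousLinearMap.proj (R := ℂ) (φ := fun _ : PBond P j => MatA 2) (coverBondAt P j b.1),
    fun _ => rfl⟩

open Classical in
/-- The window chart is onto (standing range): extend a window configuration along the (injective) cover, by `0` elsewhere. [cite: Balaban1987RG1, (1.21) p.264 (bookkeeping)] -/
theorem restrictZ_comp_coverBondAt_surjective (hj : j + 1 ≤ P.m + P.K) (ĉ : (Fin P.d → ℤ) × Fin P.d) :
    Function.Surjective (fun W : PBond P j → MatA 2 => restrictZ (winBondsZ P.L ĉ) (fun b => W (coverBondAt P j b))) := by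
  intro w
  refine ⟨fun b => if h : ∃ b' ∈ winBondsZ P.L ĉ, coverBondAt P j b' = b then w ⟨h.choose, h.choose_spec.1⟩ else 0, ?_⟩
  funext b
  have hex : ∃ b' ∈ winBondsZ P.L ĉ, coverBondAt P j b' = coverBondAt P j b.1 := ⟨b.1, b.2, rfl⟩
  simp only [restrictZ, dif_pos hex]
  congr 1
  exact Subtype.ext (coverBondAt_injOn_winBondsZ hj ĉ hex.choose_spec.1 b.2 hex.choose_spec.2)

/-- **The (0.4) average as a function on the torus factors through the window chart**: `avgMh W (π_{j+1} ĉ) = avgMhZW L ĉ (W ∘ π_j |_window)` for EVERY `W`.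
[cite: Balaban1987RG1, (0.4) p.253, p.267, (1.21) p.264] -/
theorem avgMh_coverBondAt_eq_avgMhZW (hj : j + 1 ≤ P.m + P.K) (W : PBond P j → MatA 2) (ĉ : (Fin P.d → ℤ) × Fin P.d) :
    avgMh W (coverBondAt P (j + 1) ĉ) = avgMhZW P.L ĉ (restrictZ (winBondsZ P.L ĉ) (fun b => W (coverBondAt P j b))) := by
  rw [avgMhZW_restrictZ (AveragingRT.two_mul_half_add_one P), avgMhZ_comp_coverBondAt hj]

open Classical in
/-- A single-bond field pulled back through the cover and restricted to the window is the single-bond field at the unique window preimage. [cite: Balaban1987RG1, (1.21) p.264 (bookkeeping)] -/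
theorem restrictZ_single_coverBondAt (hj : j + 1 ≤ P.m + P.K) (ĉ : (Fin P.d → ℤ) × Fin P.d) {β : (Fin P.d → ℤ) × Fin P.d} (hβ : β ∈ winBondsZ P.L ĉ) (Y : MatA 2) :
    restrictZ (winBondsZ P.L ĉ) (fun b => (Pi.single (coverBondAt P j β) Y : PBond P j → MatA 2) (coverBondAt P j b)) =
      restrictZ (winBondsZ P.L ĉ) (Pi.single β Y) := by
  funext b
  simp only [restrictZ]
  by_cases h : b.1 = β
  · rw [h, Pi.single_eq_same, Pi.single_eq_same]
  · have h' : coverBondAt P j b.1 ≠ coverBondAt P j β := fun h'' => h (coverBondAt_injOn_winBondsZ hj ĉ b.2 hβ h'')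
    rw [Pi.single_eq_of_ne h', Pi.single_eq_of_ne h]

/-- ★★ **THE DERIVATIVE BLOCK UNDER THE COVER**: `A₁^ℂ(π_{j+1} ĉ)(W) = A₁^ℤ(ĉ)(W ∘ π_j)` for EVERY level-`j` torus configuration `W` (standing range) — the torus block factors through the
surjective window chart, on which `fderiv` is computed unconditionally (`fderiv_comp_surjective_clm`). [cite: Balaban1987RG1, p.267 («h(c)»), (1.21) p.264] -/
theorem jacBlockCt_coverBondAt (hj : j + 1 ≤ P.m + P.K) (W : PBond P j → MatA 2) (ĉ : (Fin P.d → ℤ) × Fin P.d) :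
    jacBlockCt (coverBondAt P (j + 1) ĉ) W = jacBlockZ P.L ĉ (fun b => W (coverBondAt P j b)) := by
  have hL := AveragingRT.two_mul_half_add_one P
  obtain ⟨ρ, hρ⟩ := exists_winChart (P := P) (j := j) ĉ
  have hsurj : Function.Surjective ρ := by
    have : (ρ : (PBond P j → MatA 2) → _) = fun W => restrictZ (winBondsZ P.L ĉ) (fun b => W (coverBondAt P j b)) := funext hρ
    rw [this]; exact restrictZ_comp_coverBondAt_surjective hj ĉ
  have hfac : (fun W' : PBond P j → MatA 2 => avgMh W' (coverBondAt P (j + 1) ĉ)) = avgMhZW P.L ĉ ∘ ρ := by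
    funext W'
    rw [Function.comp_apply, hρ, avgMh_coverBondAt_eq_avgMhZW hj]
  ext i a
  simp only [jacBlockCt, jacBlockZ, Matrix.of_apply]
  rw [hfac, fderiv_comp_surjective_clm _ ρ hsurj, hρ, hρ, ← coverBondAt_centralBondZ hj, restrictZ_single_coverBondAt hj ĉ (centralBondZ_mem_winBondsZ hL ĉ),
    avgMhZ_comp_coverBondAt hj]

/-- ★★ **The Jacobian factor under the cover.** [cite: Balaban1987RG1, p.268, (1.21) p.264] -/
theorem jacFactorCt_coverBondAt (hj : j + 1 ≤ P.m + P.K) (W : PBond P j → MatA 2) (ĉ : (Fin P.d → ℤ) × Fin P.d) :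
    jacFactorCt (coverBondAt P (j + 1) ĉ) W = jacFactorZ P.L ĉ (fun b => W (coverBondAt P j b)) := by
  rw [jacFactorCt, jacFactorZ, jacBlockCt_coverBondAt hj]

/-- ★★★ **THE JACOBIAN FUNCTIONAL UNDER THE COVER**: `J_T(π_{k+1} ĉ, 𝐔) = J_ℤ(ĉ, 𝐔 ∘ π_0)` for EVERY complex fine configuration `𝐔` on the torus and EVERY integer coarse bond `ĉ`
(standing range `k + 1 ≤ m + K`) — [I] (1.21)'s «T^{(j+1)} ↗ Z^d» for the δ-Jacobian pieces, as an identity of total functions. [cite: Balaban1987RG1, (1.21) p.264, p.268, (0.21) p.256] -/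
theorem jacTorus_coverBondAt {k : ℕ} (hk : k + 1 ≤ P.m + P.K) (U : PBond P 0 → MatA 2) (ĉ : (Fin P.d → ℤ) × Fin P.d) :
    jacTorus k (coverBondAt P (k + 1) ĉ) U = jacZ P.L k ĉ (fun b => U (coverBondAt P 0 b)) := by
  rw [jacTorus, jacZ, iterMhZ_comp_coverBondAt k (Nat.le_of_succ_le hk) U, jacFactorCt_coverBondAt hk]

end DerivBridge

end Summit.QuantumFields.YangMills.Theorems.BalabanUVNodesPortS1

end
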